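import Summits.KontsevichZagierPeriods.Zeta5Search.WellPoisedFaceGrowth
import Summits.KontsevichZagierPeriods.Zeta5Search.DualSeriesDenominators
import Literature.NumberTheory.Transcendental.BallRivoalLinearForms
import HarnessLib

/-!
# ζ(5) search — the face forms ARE linear forms `A·ζ(5) − B` over `ℚ` (cell `pub-zeta5`, fam-vwp gen 7)

HONEST FRAMING: systematic search; no irrationality claim unless certified.

LANE NOTE (P2 g3 filing lane, 2026-08-21, announced mechanical split — mathematics VERBATIM): fam-vwp gen 7 staged
this as ONE 590-line file `WellPoisedFaceLinearForms.lean` (sha256 1e6c5c36…); the gate caps files at 400 lines, so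
§§1–3 (rational skeleton + partial fractions, well-poised reflection, real-analytic bridge) are THIS module
`WellPoisedFaceLinearFormsPF`, and §§4–6 (decay/data parity, summation, denominators and the theorems
`faceF_linearForm`, `faceF_mem`, `faceLambda_mem_ratSpan`) are `WellPoisedFaceLinearForms`, which imports it.
The overview below is the designer's, unchanged.

Files 1–5 of fam-vwp gen 6 (`WellPoisedFaceEnvelope`, `…BoundaryRate`, `…Convexity`, `…Sandwich`, `…Growth`)
prove in the kernel that on the numerator-free face `h₁ = h₂ = h₃ = 1` of Zudilin's `ζ(5)`-only well-poised box
(`r = 3`, `q = 7`, [cite: Zudilin2004, §8 (8.6)–(8.9)]) the normalised forms `Λ_n = D³DDD·Φ⁻¹·F_n` tend to `+∞`;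
the MEANING of that statement — that `F_n = F(h_n) = ½ Σ_{t ≥ 0} R″(t)` is a linear form in `1` and `ζ(5)` alone
([Zudilin2004, Lemma 19]) — was left PRINTED.  THIS FILE PROVES THE MEANING IN THE KERNEL, for every integral face
direction `(η₀; 0,0,0, η₄, η₅, η₆, η₇)` with `2η_j < η₀` and every `n`:

* `faceF_linearForm`:  `F_n = A·ζ(5) − B` with RATIONAL `A, B` such that `D_{η₀ n}·A ∈ ℤ` and `D_{η₀ n}⁶·B ∈ ℤ`
  (`D_N = lcm(1,…,N)` = `Nat.lcmUpto N`);  hence `faceF_mem`: `D_{η₀ n}⁶ · F_n ∈ ℤ·ζ(5) + ℤ`, and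
  `faceLambda_mem_ratSpan`: `Λ_n ∈ ℚ·ζ(5) + ℚ`.
* In particular NO `ζ(3)` (the residues of `R` sum to zero because `t·R(t) → 0`), and NO `ζ(4)`, `ζ(6)` (the
  well-poised reflection `R(−t − h₀) = −R(t)` makes the order-2 and order-4 partial-fraction coefficients odd under
  `k ↦ h₀ − k`) — exactly the mechanism of [Zudilin2004, Lemma 19 with (8.10)] and [BallRivoal2001]/[Rivoal2000, Lemme 1].

What stays PRINTED: Lemma 19's SHARP denominator `D_{M₁}³ D_{M₂} D_{M₃} D_{M₄}` (order-dependent pole windows) in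
place of the generic `D_{η₀ n}⁶`, and the `Φ⁻¹` saving (Lemmas 17–18); i.e. `Λ_n ∈ ℤζ(5) + ℤ` itself.  With it or
without it the face forms prove nothing about `ζ(5)` (they grow: file 5, `faceLambda_tendsto_atTop`).

METHOD — no new mathematics, an INSTANTIATION of tree machinery: the four face bricks
`(h₀ − 2h_j)!/(t + h_j)_{h₀−2h_j+1}` are sub-block reciprocal bricks of the frame `(t+1)_{h₀−1}`
(`PFSteps.subBlock_eq_brickEval`), their product gets Ball–Rivoal partial-fraction data with `d^{3−o} c_{o,p} ∈ ℤ`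
(`BallRivoal.exists_pf_prod`, `d = D_{η₀ n}`), the very-well-poised factor `h₀ + 2t` is one integer linear step
(`PFSteps.linStep`); the rational identity is transported to `ℝ` by density (continuity of `faceR` from file 3's
`hasDerivAt_faceR`), differentiated twice termwise, and summed with `BallRivoal.hasSum_one_div_pow_shift`
(`Σ_{t≥0} (t+p+1)^{−s} = ζ(s) − H_p^{(s)}`); `t·R(t) → 0` is file 3's `faceR_decay`; the reflection is proved here
(`faceRQ_reflect`) and turned into the parity of the data by `BallRivoal.pfEval_reflect` + `pf_unique`.
Standard axioms only.
-/

noncomputable section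

open Finset Filter Topology

namespace Summit.KontsevichZagierPeriods.Zeta5Search.WellPoisedFaceRate

open Literature.NumberTheory.Transcendental (zetaValue)
open Literature.NumberTheory.Transcendental.BallRivoal (pfEval brickEval IsInt poch harm exists_pf_prod pfEval_add
  pfEval_reflect pf_unique tendsto_mul_pfEval hasSum_one_div_pow_shift isInt_dpow_mul_harm)
open Summit.KontsevichZagierPeriods.Zeta5Search.PFSteps (linStep subRes trunc pfEval_linStep linStep_of_le
  isInt_linStep pfEval_trunc isInt_trunc trunc_of_le subBlock_eq_brickEval)
open Summit.KontsevichZagierPeriods.Zeta5Search.DualSeriesDenominators (natCast_dvd_lcmUpto)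

/-! ## 1. The rational skeleton of `R` on the face and its partial fractions -/

/-- `η` extended to all of `ℕ` (slots `≥ 4` unused), to index the bricks by `range 4`. -/
def etaN (η : Fin 4 → ℕ) (s : ℕ) : ℕ := if h : s < 4 then η ⟨s, h⟩ else 0

/-- `etaN` agrees with `η` on `Fin 4`. -/
theorem etaN_fin (η : Fin 4 → ℕ) (j : Fin 4) : etaN η j = η j := by
  simp [etaN, j.isLt]

/-- Residues of the four face bricks in the frame `(t+1)_{η₀ n + 1}`: brick `s` is the sub-block brick at offset
`a_s = η_s n` (first pole `t + h_s`, `h_s = η_s n + 1`) of length `L_s = h₀ − 2h_s + 1`. -/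
def brickRes (η₀ : ℕ) (η : Fin 4 → ℕ) (n : ℕ) : ℕ → ℕ → ℤ :=
  fun s => subRes (etaN η s * n) ((η₀ * n + 2) - 2 * (etaN η s * n + 1) + 1)

/-- Zudilin's `R(t)` on the face with RATIONAL argument: the same expression as file 2's real `faceR`. -/
def faceRQ (η₀ : ℕ) (η : Fin 4 → ℕ) (n : ℕ) (t : ℚ) : ℚ :=
  (((η₀ * n + 2 : ℕ) : ℚ) + 2 * t) * ∏ j : Fin 4,
    ((((η₀ * n + 2) - 2 * (η j * n + 1)).factorial : ℕ) : ℚ)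
      / ∏ i ∈ Finset.range ((η₀ * n + 2) - 2 * (η j * n + 1) + 1), (t + ((η j * n + 1 : ℕ) : ℚ) + (i : ℚ))

variable (η₀ : ℕ) (η : Fin 4 → ℕ) (n : ℕ)

/-- `faceR` at a rational point is the cast of `faceRQ`. -/
theorem cast_faceRQ (t : ℚ) : ((faceRQ η₀ η n t : ℚ) : ℝ) = faceR η₀ η n (t : ℝ) := by
  unfold faceRQ faceR
  push_cast
  rfl

/-- One face brick is the sub-block brick of the frame: `(h₀−2h_j)!/∏_{i ≤ h₀−2h_j}(t + h_j + i) = Σ_p A_p/(t+p+1)`. -/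
theorem brick_eq_brickEval (hη : ∀ j, 2 * η j < η₀) (j : Fin 4) (t : ℚ)
    (ht : ∀ p, p ≤ η₀ * n → t + p + 1 ≠ 0) :
    ((((η₀ * n + 2) - 2 * (η j * n + 1)).factorial : ℕ) : ℚ)
        / ∏ i ∈ Finset.range ((η₀ * n + 2) - 2 * (η j * n + 1) + 1), (t + ((η j * n + 1 : ℕ) : ℚ) + (i : ℚ))
      = brickEval (η₀ * n) (brickRes η₀ η n j) t := by
  have hj := hη j
  have h2 : 2 * (η j * n) ≤ η₀ * n := by rw [← mul_assoc]; exact Nat.mul_le_mul_right n hj.le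
  have hL1 : 1 ≤ (η₀ * n + 2) - 2 * (η j * n + 1) + 1 := by omega
  have hL2 : η j * n + ((η₀ * n + 2) - 2 * (η j * n + 1) + 1) ≤ η₀ * n + 1 := by omega
  have key := subBlock_eq_brickEval (η₀ * n) (η j * n) ((η₀ * n + 2) - 2 * (η j * n + 1) + 1) hL1 hL2 t ht
  rw [show (η₀ * n + 2) - 2 * (η j * n + 1) + 1 - 1 = (η₀ * n + 2) - 2 * (η j * n + 1) by omega] at key
  simp only [brickRes, etaN_fin]
  rw [← key, poch]
  congr 1
  refine prod_congr rfl fun i _ => ?_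
  push_cast
  ring

/-- The product of the four face bricks is the Ball–Rivoal product of bricks over `range 4`. -/
theorem prod_bricks_eq (hη : ∀ j, 2 * η j < η₀) (t : ℚ) (ht : ∀ p, p ≤ η₀ * n → t + p + 1 ≠ 0) :
    ∏ j : Fin 4, ((((η₀ * n + 2) - 2 * (η j * n + 1)).factorial : ℕ) : ℚ)
        / ∏ i ∈ Finset.range ((η₀ * n + 2) - 2 * (η j * n + 1) + 1), (t + ((η j * n + 1 : ℕ) : ℚ) + (i : ℚ))
      = ∏ s ∈ range 4, brickEval (η₀ * n) (brickRes η₀ η n s) t := by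
  rw [← Fin.prod_univ_eq_prod_range (fun s => brickEval (η₀ * n) (brickRes η₀ η n s) t) 4]
  exact prod_congr rfl fun j _ => brick_eq_brickEval η₀ η n hη j t ht

/-- **Partial fractions of `R` on the face** (Ball–Rivoal data, one integer linear step for `h₀ + 2t`):
there are data `c_{o,p}` (`o < 4`, `p ≤ η₀ n`) with `D_{η₀ n}^{3−o} c_{o,p} ∈ ℤ` and a constant `C` with
`R(t) = Σ_{p,o} c_{o,p}/(t+p+1)^{o+1} + C` away from the poles (`C = 0` is proved below, from the decay of `R`). -/
theorem exists_faceData (hη : ∀ j, 2 * η j < η₀) :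
    ∃ c : ℕ → ℕ → ℚ, IsInt 4 (Nat.lcmUpto (η₀ * n)) c ∧
      ∃ C : ℚ, ∀ t : ℚ, (∀ p, p ≤ η₀ * n → t + p + 1 ≠ 0) →
        faceRQ η₀ η n t = pfEval (η₀ * n) 4 c t + C := by
  obtain ⟨c, hc, hint, -⟩ := exists_pf_prod (η₀ * n) (Nat.lcmUpto (η₀ * n))
    (fun k hk1 hk2 => natCast_dvd_lcmUpto hk1 hk2) (brickRes η₀ η n) 4 (by norm_num)
  have htr : ∀ o p, 4 ≤ o → trunc 4 c o p = 0 := fun o p ho => trunc_of_le ho p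
  refine ⟨linStep 2 ((η₀ * n + 2 : ℕ) : ℤ) (trunc 4 c), isInt_linStep _ _ htr (isInt_trunc hint),
    2 * ∑ p ∈ range (η₀ * n + 1), trunc 4 c 0 p, fun t ht => ?_⟩
  rw [pfEval_linStep (η₀ * n) 4 _ _ _ htr t ht, pfEval_trunc, hc t ht, ← prod_bricks_eq η₀ η n hη t ht]
  unfold faceRQ
  push_cast
  ring

/-! ## 2. The well-poised reflection `R(−t − h₀) = −R(t)` -/

/-- Reflection of one brick denominator: `∏_{i<L} (−t − N − 2 + h + i) = (−1)^L ∏_{i<L} (t + h + i)` whenever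
`2h + L = N + 3` (the brick `[h, h + L − 1]` is centred at `h₀/2 = (N+2)/2`). -/
theorem prod_reflect (t h NN : ℚ) (L : ℕ) (hrel : 2 * h + L = NN + 3) :
    ∏ i ∈ range L, (-t - NN - 2 + h + (i : ℚ)) = (-1) ^ L * ∏ i ∈ range L, (t + h + (i : ℚ)) := by
  have key : ∀ j ∈ range L, (-t - NN - 2 + h + (j : ℚ)) = (-1) * (t + h + ((L - 1 - j : ℕ) : ℚ)) := by
    intro j hj
    have hj' := mem_range.1 hj
    rw [Nat.cast_sub (by omega), Nat.cast_sub (by omega)]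
    push_cast
    linarith
  calc ∏ i ∈ range L, (-t - NN - 2 + h + (i : ℚ))
      = ∏ j ∈ range L, (-1) * (t + h + ((L - 1 - j : ℕ) : ℚ)) := prod_congr rfl key
    _ = ∏ j ∈ range L, (fun i : ℕ => (-1) * (t + h + (i : ℚ))) (L - 1 - j) := rfl
    _ = ∏ i ∈ range L, (-1) * (t + h + (i : ℚ)) :=
        prod_range_reflect (fun i : ℕ => (-1) * (t + h + (i : ℚ))) L
    _ = (-1) ^ L * ∏ i ∈ range L, (t + h + (i : ℚ)) := by rw [prod_mul_distrib, prod_const, card_range]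

/-- Every face brick has the same reflection sign `(−1)^{L_j} = (−1)^{η₀ n + 1}` (`L_j = (η₀ − 2η_j)n + 1`). -/
theorem brick_sign (hη : ∀ j, 2 * η j < η₀) (j : Fin 4) :
    ((-1 : ℚ)) ^ ((η₀ * n + 2) - 2 * (η j * n + 1) + 1) = (-1) ^ (η₀ * n + 1) := by
  have h2 : 2 * (η j * n) ≤ η₀ * n := by rw [← mul_assoc]; exact Nat.mul_le_mul_right n (hη j).le
  have hsum : ((η₀ * n + 2) - 2 * (η j * n + 1) + 1) + 2 * (η j * n) = η₀ * n + 1 := by omega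
  rw [← hsum, pow_add _ _ (2 * (η j * n)), pow_mul, neg_one_sq, one_pow, mul_one]

/-- **Well-poised reflection** [Zudilin2004, (8.10) with `r = 3`, face]: `R(−t − h₀) = −R(t)` (`h₀ = η₀ n + 2`),
an identity of rational functions (poles go to poles, where both sides are `0` by `x/0 = 0`). -/
theorem faceRQ_reflect (hη : ∀ j, 2 * η j < η₀) (t : ℚ) :
    faceRQ η₀ η n (-t - ((η₀ * n : ℕ) : ℚ) - 2) = -faceRQ η₀ η n t := by
  have hD : ∀ j : Fin 4,
      ∏ i ∈ Finset.range ((η₀ * n + 2) - 2 * (η j * n + 1) + 1),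
          (-t - ((η₀ * n : ℕ) : ℚ) - 2 + ((η j * n + 1 : ℕ) : ℚ) + (i : ℚ))
        = (-1) ^ (η₀ * n + 1) * ∏ i ∈ Finset.range ((η₀ * n + 2) - 2 * (η j * n + 1) + 1),
            (t + ((η j * n + 1 : ℕ) : ℚ) + (i : ℚ)) := by
    intro j
    have h2 : 2 * (η j * n) ≤ η₀ * n := by rw [← mul_assoc]; exact Nat.mul_le_mul_right n (hη j).le
    rw [← brick_sign η₀ η n hη j]
    refine prod_reflect t _ _ _ ?_
    have hle : 2 * (η j * n + 1) ≤ η₀ * n + 2 := by omega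
    push_cast
    rw [Nat.cast_sub hle]
    push_cast
    ring
  have hσ4 : (((-1 : ℚ) ^ (η₀ * n + 1))⁻¹) ^ 4 = 1 := by
    rw [inv_pow, ← pow_mul]
    rw [Even.neg_one_pow ⟨2 * (η₀ * n + 1), by ring⟩, inv_one]
  have hdiv : ∀ x y : ℚ, x / ((-1 : ℚ) ^ (η₀ * n + 1) * y) = x / y * ((-1 : ℚ) ^ (η₀ * n + 1))⁻¹ := by
    intro x y
    rw [div_mul_eq_div_div_swap, div_eq_mul_inv]
  unfold faceRQ
  simp_rw [hD, hdiv]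
  rw [prod_mul_distrib, prod_const, Finset.card_univ, Fintype.card_fin, hσ4, mul_one]
  push_cast
  ring

/-! ## 3. Real-analytic bridge: `R` and the partial fractions as real functions -/

/-- The real partial-fraction sum of data `c` on the frame `t+1, …, t+N+1`. -/
def pfR (N : ℕ) (c : ℕ → ℕ → ℚ) (y : ℝ) : ℝ :=
  ∑ p ∈ range (N + 1), ∑ o ∈ range 4, (c o p : ℝ) * ((y + ((p + 1 : ℕ) : ℝ)) ^ (o + 1))⁻¹

/-- At rational points `pfR` is the cast of Ball–Rivoal's `pfEval`. -/
theorem cast_pfEval (N : ℕ) (c : ℕ → ℕ → ℚ) (q : ℚ) : ((pfEval N 4 c q : ℚ) : ℝ) = pfR N c q := by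
  unfold pfEval pfR
  push_cast
  refine sum_congr rfl fun p _ => sum_congr rfl fun o _ => ?_
  rw [div_eq_mul_inv, show (q : ℝ) + (p : ℝ) + 1 = (q : ℝ) + ((p : ℝ) + 1) by ring]

/-- Smoothness of `y ↦ (y + a)^{−s}` where `y + a > 0` (cf. `Zudilin2004.contDiffAt_inv_pow_real`, which assumes `0 < y`
and an integer shift; here the summation starts at `t = 0`, so the weaker hypothesis `0 < y + a` is needed). -/
theorem contDiffAt_inv_pow' (a : ℝ) (s : ℕ) {k : ℝ} (hk : 0 < k + a) {N : WithTop ℕ∞} :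
    ContDiffAt ℝ N (fun y : ℝ => ((y + a) ^ s)⁻¹) k := by
  refine ((contDiffAt_id.add contDiffAt_const).pow s).inv ?_
  simp only [id]
  exact pow_ne_zero _ hk.ne'

/-- `(d/dy)² (y + a)^{−s} = s(s+1)(y + a)^{−s−2}` where `y + a > 0` (same proof as `Zudilin2004.iteratedDeriv_two_inv_pow`,
which assumes `0 < y`; the point `t = 0` of `F = ½ Σ_{t ≥ 0} R″(t)` needs this version). -/
theorem iteratedDeriv_two_inv_pow' (a : ℝ) (s : ℕ) {k : ℝ} (hk : 0 < k + a) :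
    iteratedDeriv 2 (fun y : ℝ => ((y + a) ^ s)⁻¹) k = (s : ℝ) * (s + 1) * ((k + a) ^ (s + 2))⁻¹ := by
  have hfun : (fun y : ℝ => ((y + a) ^ s)⁻¹) = fun y => (fun x : ℝ => x ^ (-(s : ℤ))) (y + a) := by
    funext y
    simp only [zpow_neg, zpow_natCast]
  rw [hfun, iteratedDeriv_comp_add_const 2 (fun x : ℝ => x ^ (-(s : ℤ))) a]
  simp only
  rw [iteratedDeriv_eq_iterate, iter_deriv_zpow]
  have hk' : (k + a : ℝ) ≠ 0 := hk.ne'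
  rw [show (-(s : ℤ) - (2 : ℕ)) = -((s + 2 : ℕ) : ℤ) by push_cast; ring, zpow_neg, zpow_natCast]
  simp [Finset.prod_range_succ]
  ring

/-- `pfR` is smooth at every `y > −1`. -/
theorem contDiffAt_pfR (N : ℕ) (c : ℕ → ℕ → ℚ) {y : ℝ} (hy : -1 < y) {M : WithTop ℕ∞} :
    ContDiffAt ℝ M (pfR N c) y := by
  unfold pfR
  refine ContDiffAt.sum fun p _ => ContDiffAt.sum fun o _ => contDiffAt_const.mul (contDiffAt_inv_pow' _ _ ?_)
  push_cast
  linarith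

/-- Termwise second derivative of `pfR` at `y > −1`. -/
theorem iteratedDeriv_two_pfR (N : ℕ) (c : ℕ → ℕ → ℚ) {y : ℝ} (hy : -1 < y) :
    iteratedDeriv 2 (pfR N c) y = ∑ p ∈ range (N + 1), ∑ o ∈ range 4,
      (c o p : ℝ) * ((((o + 1 : ℕ) : ℝ) * ((o + 1 : ℕ) + 1)) * ((y + ((p + 1 : ℕ) : ℝ)) ^ (o + 1 + 2))⁻¹) := by
  have hpos : ∀ p : ℕ, 0 < y + ((p + 1 : ℕ) : ℝ) := fun p => by push_cast; linarith
  unfold pfR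
  rw [iteratedDeriv_fun_sum fun p _ =>
    ContDiffAt.sum fun o _ => contDiffAt_const.mul (contDiffAt_inv_pow' _ _ (hpos p))]
  refine sum_congr rfl fun p _ => ?_
  rw [iteratedDeriv_fun_sum fun o _ => contDiffAt_const.mul (contDiffAt_inv_pow' _ _ (hpos p))]
  refine sum_congr rfl fun o _ => ?_
  rw [iteratedDeriv_const_mul _ (contDiffAt_inv_pow' _ _ (hpos p)), iteratedDeriv_two_inv_pow' _ _ (hpos p)]

/-- **`R = partial fractions + C` as REAL functions on `y > −1/2`** (from the rational identity by density of `ℚ`: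
`faceR` is continuous there by file 3's `hasDerivAt_faceR`, and so is `pfR`). -/
theorem faceR_eq_pfR {c : ℕ → ℕ → ℚ} {C : ℚ}
    (hc : ∀ t : ℚ, (∀ p, p ≤ η₀ * n → t + p + 1 ≠ 0) → faceRQ η₀ η n t = pfEval (η₀ * n) 4 c t + C)
    {y : ℝ} (hy : -1/2 < y) : faceR η₀ η n y = pfR (η₀ * n) c y + C := by
  set f : ℝ → ℝ := fun z => faceR η₀ η n z - (pfR (η₀ * n) c z + C) with hf
  have hfc : ContinuousAt f y :=
    (hasDerivAt_faceR η₀ η n hy).continuousAt.sub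
      (((contDiffAt_pfR (η₀ * n) c (by linarith) (M := 0)).continuousAt).add continuousAt_const)
  haveI : (𝓝[Set.range ((↑) : ℚ → ℝ)] y).NeBot := Rat.denseRange_cast.nhdsWithin_neBot y
  have h1 : Tendsto f (𝓝[Set.range ((↑) : ℚ → ℝ)] y) (𝓝 (f y)) :=
    hfc.tendsto.mono_left nhdsWithin_le_nhds
  have h2 : f =ᶠ[𝓝[Set.range ((↑) : ℚ → ℝ)] y] fun _ => 0 := by
    have hpos : ∀ᶠ z in 𝓝[Set.range ((↑) : ℚ → ℝ)] y, -1/2 < z :=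
      mem_nhdsWithin_of_mem_nhds (Ioi_mem_nhds hy)
    filter_upwards [hpos, self_mem_nhdsWithin] with z hz hmem
    obtain ⟨q, rfl⟩ := hmem
    have hz' : (-1/2 : ℝ) < (q : ℝ) := hz
    have hq : ∀ p, p ≤ η₀ * n → (q : ℚ) + p + 1 ≠ 0 := by
      intro p _ h0
      have h0' : ((q : ℚ) : ℝ) + (p : ℝ) + 1 = 0 := by exact_mod_cast h0
      have hp0 : (0 : ℝ) ≤ (p : ℝ) := by positivity
      linarith
    have e := hc q hq
    have e' : faceR η₀ η n (q : ℝ) = pfR (η₀ * n) c q + (C : ℝ) := by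
      rw [← cast_faceRQ, e, Rat.cast_add, cast_pfEval]
    simp only [hf, e', sub_self]
  have := tendsto_nhds_unique (h1.congr' h2) tendsto_const_nhds
  simp only [hf] at this
  linarith

end Summit.KontsevichZagierPeriods.Zeta5Search.WellPoisedFaceRate
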